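import Summits.QuantumFields.YangMills.Theorems.AllWindowsColdBoxBoxHighLineSmallFieldInsideFPCore
import Summits.QuantumFields.YangMills.Theorems.AllWindowsColdBoxBoxHighLineVarianceBounded

/-!
# T-S5.6 `SmallFieldInsideFP` from the action sandwich (T-S5.6a) and a determinant comparison on small fields (6b)
# (STUB-PLAN-S5-STEP2 §5, planner ym-idea-2 g18 18:56:41Z / 19:07:07Z «conditional form 'smallFieldInsideFP_of (h6a : ActionSandwich)' first is fine»;
# LINE-19 S5 ⟨stmt-QuantumFields-24004⟩/⟨24335⟩, LINE-20 U5 ⟨24336⟩; Props from ✓`…Step2Defs` BY NAME)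

Width seat `ym-line-sfw-p2-w4` (prover-ym-line-sfw-p2-w4-g27-0), T-S5.6 holder.  **`smallFieldInsideFP_of (h6a : ActionSandwich) (h6b : …) : SmallFieldInsideFP`**,
where `h6b` is the two-configuration determinant comparison on small fields
`∃ C₇ c₇, 0 < c₇ ∧ ∀ H ≥ 1, ∀ t ≥ 0, t·H² ≤ c₇ → ∀ a a′ ∈ smallField H t, |det F(edgeChart a)| ≤ e^{C₇·t·H⁵}·|det F(edgeChart a′)|`
(the 6b input; w2's ✓4r `logDetSecondOrder` + locality of `F(U) − F(1)` + ✓T-S5.9 is the intended route; NOT proved here).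
Assembly (all inputs by name): support localisation ✓`EdgeChart.fpChartWeight_eq_zero_of_not_smallField` (`T = π·r`), pointwise sandwich
✓`FPChart.*`, relative Gaussian tails / box mass / mass ratio ✓`ChartGauss.*` with the variances ✓S3a `landauVarianceBounded`, the two integral bounds
✓`SmallFieldFP.setIntegral_diff_le` / `le_setIntegral_smallField`, `|LandauFree H| ≤ 216H⁴`; constants `C = 2592 + 216 + 1296π·C₆⁺ + 2π·C₇⁺ + 144·C₃`,
`c = (6C₃)⁻¹`, `c₀ = min(c₆/π, c₇/π, (2πC₆⁺+1)⁻¹, 1)`.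

Everything proved; no definitions; standard axioms.  HONEST LABEL: T-S5.6 is proved CONDITIONALLY on T-S5.6a (w2) and on the 6b determinant comparison (untyped by
the planner; stated here as a hypothesis); S5, U5 and the items ⟨24004⟩ ⟨24335⟩ ⟨24336⟩ remain OPEN; no stub is closed by name, no crux, rung or summit is
proved; the Yang–Mills mass gap is NOT proved by this file.
-/

set_option autoImplicit false

open MeasureTheory Real Finset

namespace Summit.QuantumFields.YangMills.Theorems.AllWindowsColdBoxBoxHighLine

namespace SmallFieldFP

/-! ## Two elementary exponential bounds -/

/-- `√((1+ε)/(1−ε)) ≤ e^{2ε}` for `0 ≤ ε ≤ 1/2`. -/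
theorem sqrt_ratio_le_exp {ε : ℝ} (h0 : 0 ≤ ε) (h1 : ε ≤ 1 / 2) : Real.sqrt ((1 + ε) / (1 - ε)) ≤ Real.exp (2 * ε) := by
  have hy : (1 + ε) / (1 - ε) ≤ (1 + 2 * ε) ^ 2 := by
    rw [div_le_iff₀ (by linarith)]
    have h2 : 0 ≤ 1 - 2 * ε ^ 2 := by nlinarith
    nlinarith [mul_nonneg h0 h2, mul_nonneg (mul_nonneg h0 h0) h0]
  calc Real.sqrt ((1 + ε) / (1 - ε)) ≤ Real.sqrt ((1 + 2 * ε) ^ 2) := Real.sqrt_le_sqrt hy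
    _ = 1 + 2 * ε := Real.sqrt_sq (by linarith)
    _ ≤ Real.exp (2 * ε) := by linarith [Real.add_one_le_exp (2 * ε)]

/-- `2592·x ≤ e^{12·(1 + log x)}·… `: concretely `2592 · H⁴ · e^{−a(1 + log H)} ≤ 1` for `a ≥ 12`, `H ≥ 1`. -/
theorem card_mul_exp_neg_le_one {H : ℕ} (hH : 1 ≤ H) {a : ℝ} (ha : 12 ≤ a) :
    2592 * (H : ℝ) ^ 4 * Real.exp (-(a * (1 + Real.log H))) ≤ 1 := by
  have hH' : (1 : ℝ) ≤ H := by exact_mod_cast hH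
  have hlog : 0 ≤ Real.log H := Real.log_nonneg hH'
  -- `e^{−a(1+log H)} ≤ e^{−12}·e^{−4 log H} = e^{−12}/H⁴`
  have h1 : Real.exp (-(a * (1 + Real.log H))) ≤ Real.exp (-12) * ((H : ℝ) ^ 4)⁻¹ := by
    have hle : -(a * (1 + Real.log H)) ≤ -12 + -(4 * Real.log H) := by
      nlinarith [mul_le_mul_of_nonneg_right ha hlog]
    calc Real.exp (-(a * (1 + Real.log H))) ≤ Real.exp (-12 + -(4 * Real.log H)) := Real.exp_le_exp.2 hle
      _ = Real.exp (-12) * ((H : ℝ) ^ 4)⁻¹ := by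
          rw [Real.exp_add, Real.exp_neg (4 * Real.log H),
            show (4 : ℝ) * Real.log H = Real.log ((H : ℝ) ^ 4) by rw [Real.log_pow]; norm_num, Real.exp_log (by positivity)]
  -- `e^{12} ≥ 2^{12} = 4096 ≥ 2592`
  have h2 : (2592 : ℝ) ≤ Real.exp 12 := by
    have he : (2 : ℝ) ≤ Real.exp 1 := by linarith [Real.exp_one_gt_d9]
    have h12 : Real.exp 12 = Real.exp 1 ^ 12 := by rw [← Real.exp_nat_mul]; norm_num
    rw [h12]
    calc (2592 : ℝ) ≤ 2 ^ 12 := by norm_num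
      _ ≤ Real.exp 1 ^ 12 := pow_le_pow_left₀ (by norm_num) he 12
  have hH4 : 0 < (H : ℝ) ^ 4 := by positivity
  calc 2592 * (H : ℝ) ^ 4 * Real.exp (-(a * (1 + Real.log H)))
      ≤ 2592 * (H : ℝ) ^ 4 * (Real.exp (-12) * ((H : ℝ) ^ 4)⁻¹) := mul_le_mul_of_nonneg_left h1 (by positivity)
    _ = 2592 * Real.exp (-12) := by field_simp
    _ ≤ Real.exp 12 * Real.exp (-12) := mul_le_mul_of_nonneg_right h2 (Real.exp_pos _).le
    _ = 1 := by rw [← Real.exp_add]; norm_num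

/-- The denominator keeps half the Gaussian mass: `1/2 ≤ 1 − 6n·e^{−β(1+ε)(s/2)²/(3C₃)}` when `C(1+log H) ≤ βs²`, `144C₃ ≤ C`, `n ≤ 216H⁴`. -/
theorem half_le_one_sub {H : ℕ} (hH : 1 ≤ H) {n β s ε C₃ C : ℝ} (hβ : 0 < β) (hn : n ≤ 216 * (H : ℝ) ^ 4)
    (hε0 : 0 ≤ ε) (hC₃ : 0 < C₃) (hC : 144 * C₃ ≤ C) (hCβ : C * (1 + Real.log H) ≤ β * s ^ 2) :
    1 / 2 ≤ 1 - 6 * n * Real.exp (-(β * (1 + ε) * (s / 2) ^ 2 / (3 * C₃))) := by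
  have hH' : (1 : ℝ) ≤ H := by exact_mod_cast hH
  have hlog : 0 ≤ Real.log H := Real.log_nonneg hH'
  have hE : Real.exp (-(β * (1 + ε) * (s / 2) ^ 2 / (3 * C₃))) ≤ Real.exp (-(12 * (1 + Real.log H))) := by
    refine Real.exp_le_exp.2 (neg_le_neg ?_)
    rw [le_div_iff₀ (by positivity)]
    have h1 : 144 * C₃ * (1 + Real.log H) ≤ C * (1 + Real.log H) := mul_le_mul_of_nonneg_right hC (by linarith)
    nlinarith [mul_nonneg hβ.le (mul_nonneg hε0 (sq_nonneg s))]
  have h2 : 12 * n * Real.exp (-(β * (1 + ε) * (s / 2) ^ 2 / (3 * C₃))) ≤ 2592 * (H : ℝ) ^ 4 * Real.exp (-(12 * (1 + Real.log H))) :=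
    mul_le_mul (by linarith) hE (Real.exp_pos _).le (by positivity)
  have h3 := card_mul_exp_neg_le_one hH (le_refl (12 : ℝ))
  linarith

/-- **The bracket of constants** in front of the denominator: with `n ≤ 216H⁴`, `N = 3n`, `ε = C₆⁺πrH ≤ 1/2`, `4s ≤ r ≤ 1`,
`12n · e^{−β(1−ε)s²/(3C₃)} · √((β(1+ε))/(β(1−ε)))^N · (e^{C₇⁺πrH⁵})² · e^{n((s/2)²/3+(s/2)⁴)} ≤ C·H⁴·e^{C r H⁵ − βs²/(6C₃)}`,
`C = 2592 + (216 + 1296πC₆⁺ + 2πC₇⁺) + 144C₃`. -/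
theorem bracket_le {H N : ℕ} (hH : 1 ≤ H) {n β r s ε C₃ C₆p C₇p : ℝ} (hβ : 0 < β) (hs : 0 < s) (hsr : 4 * s ≤ r) (hr1 : r ≤ 1)
    (hn : n ≤ 216 * (H : ℝ) ^ 4) (hN : (N : ℝ) = 3 * n) (hε0 : 0 ≤ ε) (hεle : ε ≤ 1 / 2)
    (hεdef : ε = C₆p * (Real.pi * r) * H) (hC₆p : 0 ≤ C₆p) (hC₇p : 0 ≤ C₇p) (hC₃ : 0 < C₃) :
    12 * n * Real.exp (-(β * (1 - ε) * s ^ 2 / (3 * C₃))) * Real.sqrt (β * (1 + ε) / (β * (1 - ε))) ^ N *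
        Real.exp (C₇p * (Real.pi * r) * (H : ℝ) ^ 5) ^ 2 * Real.exp (n * ((s / 2) ^ 2 / 3 + (s / 2) ^ 4)) ≤
      (2592 + (216 + 1296 * Real.pi * C₆p + 2 * Real.pi * C₇p) + 144 * C₃) * (H : ℝ) ^ 4 *
        Real.exp ((2592 + (216 + 1296 * Real.pi * C₆p + 2 * Real.pi * C₇p) + 144 * C₃) * r * (H : ℝ) ^ 5 - 1 / (6 * C₃) * β * s ^ 2) := by
  have hH' : (1 : ℝ) ≤ H := by exact_mod_cast hH
  have hπ : 0 < Real.pi := Real.pi_pos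
  have hr : 0 < r := by linarith
  have hCexp0 : 0 ≤ 216 + 1296 * Real.pi * C₆p + 2 * Real.pi * C₇p := by positivity
  have hC0 : 0 ≤ 2592 + (216 + 1296 * Real.pi * C₆p + 2 * Real.pi * C₇p) + 144 * C₃ := by positivity
  have hsr2 : s ^ 2 ≤ r := by
    have hs1 : 0 ≤ 1 - s := by linarith
    nlinarith [mul_nonneg hs.le hs1]
  have ht1 : s / 2 ≤ 1 := by linarith
  have hφ : (s / 2) ^ 2 / 3 + (s / 2) ^ 4 ≤ s ^ 2 := by
    have h4 : (s / 2) ^ 4 ≤ (s / 2) ^ 2 := by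
      have : (s / 2) ^ 4 = (s / 2) ^ 2 * (s / 2) ^ 2 := by ring
      rw [this]; exact mul_le_of_le_one_left (sq_nonneg _) (by nlinarith)
    nlinarith [sq_nonneg s]
  have hrH5 : 0 ≤ r * (H : ℝ) ^ 5 := by positivity
  -- the four exponential factors
  have e1 : Real.exp (-(β * (1 - ε) * s ^ 2 / (3 * C₃))) ≤ Real.exp (-(1 / (6 * C₃) * β * s ^ 2)) := by
    have key : 1 / (6 * C₃) * β * s ^ 2 ≤ β * (1 - ε) * s ^ 2 / (3 * C₃) := by
      rw [le_div_iff₀ (by positivity)]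
      have e : 1 / (6 * C₃) * β * s ^ 2 * (3 * C₃) = β * s ^ 2 / 2 := by
        field_simp
        ring
      rw [e]
      nlinarith [mul_nonneg hβ.le (sq_nonneg s)]
    exact Real.exp_le_exp.2 (by linarith)
  have e2 : Real.sqrt (β * (1 + ε) / (β * (1 - ε))) ^ N ≤ Real.exp (1296 * Real.pi * C₆p * (r * (H : ℝ) ^ 5)) := by
    have h1 : Real.sqrt (β * (1 + ε) / (β * (1 - ε))) ≤ Real.exp (2 * ε) := by
      rw [mul_div_mul_left _ _ hβ.ne']
      exact sqrt_ratio_le_exp hε0 hεle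
    calc Real.sqrt (β * (1 + ε) / (β * (1 - ε))) ^ N ≤ Real.exp (2 * ε) ^ N := pow_le_pow_left₀ (Real.sqrt_nonneg _) h1 _
      _ = Real.exp (6 * n * ε) := by rw [← Real.exp_nat_mul, hN]; ring_nf
      _ ≤ Real.exp (1296 * Real.pi * C₆p * (r * (H : ℝ) ^ 5)) := by
          refine Real.exp_le_exp.2 ?_
          rw [hεdef]
          calc 6 * n * (C₆p * (Real.pi * r) * H) ≤ 6 * (216 * (H : ℝ) ^ 4) * (C₆p * (Real.pi * r) * H) :=
                mul_le_mul_of_nonneg_right (by linarith) (by positivity)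
            _ = 1296 * Real.pi * C₆p * (r * (H : ℝ) ^ 5) := by ring
  have e3 : Real.exp (C₇p * (Real.pi * r) * (H : ℝ) ^ 5) ^ 2 = Real.exp (2 * Real.pi * C₇p * (r * (H : ℝ) ^ 5)) := by
    rw [← Real.exp_nat_mul]; ring_nf
  have e4 : Real.exp (n * ((s / 2) ^ 2 / 3 + (s / 2) ^ 4)) ≤ Real.exp (216 * (r * (H : ℝ) ^ 5)) := by
    refine Real.exp_le_exp.2 ?_
    calc n * ((s / 2) ^ 2 / 3 + (s / 2) ^ 4) ≤ 216 * (H : ℝ) ^ 4 * s ^ 2 := mul_le_mul hn hφ (by positivity) (by positivity)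
      _ ≤ 216 * (H : ℝ) ^ 4 * (r * H) := by
          refine mul_le_mul_of_nonneg_left ?_ (by positivity)
          nlinarith [mul_nonneg hr.le (sub_nonneg.2 hH')]
      _ = 216 * (r * (H : ℝ) ^ 5) := by ring
  have hprod : Real.exp (-(β * (1 - ε) * s ^ 2 / (3 * C₃))) * Real.sqrt (β * (1 + ε) / (β * (1 - ε))) ^ N *
      Real.exp (C₇p * (Real.pi * r) * (H : ℝ) ^ 5) ^ 2 * Real.exp (n * ((s / 2) ^ 2 / 3 + (s / 2) ^ 4)) ≤
      Real.exp ((2592 + (216 + 1296 * Real.pi * C₆p + 2 * Real.pi * C₇p) + 144 * C₃) * r * (H : ℝ) ^ 5 - 1 / (6 * C₃) * β * s ^ 2) := by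
    calc Real.exp (-(β * (1 - ε) * s ^ 2 / (3 * C₃))) * Real.sqrt (β * (1 + ε) / (β * (1 - ε))) ^ N *
          Real.exp (C₇p * (Real.pi * r) * (H : ℝ) ^ 5) ^ 2 * Real.exp (n * ((s / 2) ^ 2 / 3 + (s / 2) ^ 4))
        ≤ Real.exp (-(1 / (6 * C₃) * β * s ^ 2)) * Real.exp (1296 * Real.pi * C₆p * (r * (H : ℝ) ^ 5)) *
            Real.exp (2 * Real.pi * C₇p * (r * (H : ℝ) ^ 5)) * Real.exp (216 * (r * (H : ℝ) ^ 5)) := by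
          rw [e3]; gcongr
      _ = Real.exp ((216 + 1296 * Real.pi * C₆p + 2 * Real.pi * C₇p) * (r * (H : ℝ) ^ 5) - 1 / (6 * C₃) * β * s ^ 2) := by
          rw [← Real.exp_add, ← Real.exp_add, ← Real.exp_add]; ring_nf
      _ ≤ _ := by
          refine Real.exp_le_exp.2 ?_
          have : (216 + 1296 * Real.pi * C₆p + 2 * Real.pi * C₇p) * (r * (H : ℝ) ^ 5) ≤
              (2592 + (216 + 1296 * Real.pi * C₆p + 2 * Real.pi * C₇p) + 144 * C₃) * (r * (H : ℝ) ^ 5) :=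
            mul_le_mul_of_nonneg_right (by linarith) hrH5
          linarith
  have h12 : 12 * n ≤ (2592 + (216 + 1296 * Real.pi * C₆p + 2 * Real.pi * C₇p) + 144 * C₃) * (H : ℝ) ^ 4 := by
    calc 12 * n ≤ 2592 * (H : ℝ) ^ 4 := by linarith
      _ ≤ _ := mul_le_mul_of_nonneg_right (by linarith) (by positivity)
  calc 12 * n * Real.exp (-(β * (1 - ε) * s ^ 2 / (3 * C₃))) * Real.sqrt (β * (1 + ε) / (β * (1 - ε))) ^ N *
        Real.exp (C₇p * (Real.pi * r) * (H : ℝ) ^ 5) ^ 2 * Real.exp (n * ((s / 2) ^ 2 / 3 + (s / 2) ^ 4))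
      = (12 * n) * (Real.exp (-(β * (1 - ε) * s ^ 2 / (3 * C₃))) * Real.sqrt (β * (1 + ε) / (β * (1 - ε))) ^ N *
          Real.exp (C₇p * (Real.pi * r) * (H : ℝ) ^ 5) ^ 2 * Real.exp (n * ((s / 2) ^ 2 / 3 + (s / 2) ^ 4))) := by ring
    _ ≤ _ := mul_le_mul h12 hprod (by positivity) (by positivity)

/-! ## The assembly -/

/-- **T-S5.6 `SmallFieldInsideFP`, conditional on T-S5.6a and on the 6b determinant comparison.** -/
theorem smallFieldInsideFP_of (h6a : ActionSandwich)
    (h6b : ∃ C₇ c₇ : ℝ, 0 < c₇ ∧ ∀ H : ℕ, 1 ≤ H → ∀ t : ℝ, 0 ≤ t → t * (H : ℝ) ^ 2 ≤ c₇ →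
      ∀ a a' : LandauFree H → E3, a ∈ smallField H t → a' ∈ smallField H t →
        |(fpOperator H (edgeChart H a)).det| ≤ Real.exp (C₇ * t * (H : ℝ) ^ 5) * |(fpOperator H (edgeChart H a')).det|) :
    SmallFieldInsideFP := by
  obtain ⟨C₆, c₆, hc₆, h6a⟩ := h6a
  obtain ⟨C₇, c₇, hc₇, h6b⟩ := h6b
  obtain ⟨C₃', hC₃'⟩ := landauVarianceBounded
  -- positive versions of the constants
  set C₆p := max C₆ 0 with hC₆p
  set C₇p := max C₇ 0 with hC₇p
  set C₃ := max C₃' 1 with hC₃def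
  have hC₆p0 : 0 ≤ C₆p := le_max_right _ _
  have hC₇p0 : 0 ≤ C₇p := le_max_right _ _
  have hC₃ : 1 ≤ C₃ := le_max_right _ _
  have hC₃pos : 0 < C₃ := by linarith
  have hπ : 0 < Real.pi := Real.pi_pos
  have hπ3 : 3 < Real.pi := Real.pi_gt_three
  -- the constants of the statement
  set c₀ : ℝ := min (min (c₆ / Real.pi) (c₇ / Real.pi)) (min (1 / (2 * Real.pi * C₆p + 1)) 1) with hc₀def
  set Cexp : ℝ := 216 + 1296 * Real.pi * C₆p + 2 * Real.pi * C₇p with hCexp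
  set C : ℝ := 2592 + Cexp + 144 * C₃ with hCdef
  have hCexp0 : 0 ≤ Cexp := by rw [hCexp]; positivity
  have hC0 : 0 ≤ C := by rw [hCdef]; linarith only [hCexp0, hC₃pos]
  have hc₀pos : 0 < c₀ := by
    rw [hc₀def]
    refine lt_min (lt_min (div_pos hc₆ hπ) (div_pos hc₇ hπ)) (lt_min (by positivity) one_pos)
  have hc₀6 : c₀ ≤ c₆ / Real.pi := (min_le_left _ _).trans (min_le_left _ _)
  have hc₀7 : c₀ ≤ c₇ / Real.pi := (min_le_left _ _).trans (min_le_right _ _)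
  have hc₀ε : c₀ ≤ 1 / (2 * Real.pi * C₆p + 1) := (min_le_right _ _).trans (min_le_left _ _)
  have hc₀1 : c₀ ≤ 1 := (min_le_right _ _).trans (min_le_right _ _)
  refine ⟨C, 1 / (6 * C₃), c₀, by positivity, hc₀pos, ?_⟩
  intro H hH β r s hβ hs hsr hrH hCβ
  have hH' : (1 : ℝ) ≤ H := by exact_mod_cast hH
  have hβpos : 0 < β := by linarith
  have hlog : 0 ≤ Real.log H := Real.log_nonneg hH'
  have hH2 : (1 : ℝ) ≤ (H : ℝ) ^ 2 := one_le_pow₀ hH'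
  -- the basic geometry of the parameters
  have hr : 0 < r := by linarith
  have hrc : r ≤ c₀ := le_trans (le_mul_of_one_le_right hr.le hH2) hrH
  have hr1 : r ≤ 1 := hrc.trans hc₀1
  have hvar : ∀ e : LandauFree H, (hodgeQ H)⁻¹ e e ≤ C₃ := fun e => (hC₃' H hH e).trans (le_max_left _ _)
  -- the support level `T = π r`
  have hT0 : 0 ≤ Real.pi * r := by positivity
  have hHH : (H : ℝ) ≤ (H : ℝ) ^ 2 := le_self_pow₀ hH' two_ne_zero
  have hrHH : r * H ≤ r * (H : ℝ) ^ 2 := mul_le_mul_of_nonneg_left hHH hr.le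
  have hπc₆ : Real.pi * c₀ ≤ c₆ := by
    have h := (le_div_iff₀ hπ).1 hc₀6
    linarith only [h, mul_comm Real.pi c₀]
  have hπc₇ : Real.pi * c₀ ≤ c₇ := by
    have h := (le_div_iff₀ hπ).1 hc₀7
    linarith only [h, mul_comm Real.pi c₀]
  have hπrH2 : Real.pi * (r * (H : ℝ) ^ 2) ≤ Real.pi * c₀ := mul_le_mul_of_nonneg_left hrH hπ.le
  have hTH : Real.pi * r * H ≤ c₆ := by
    have h1 : Real.pi * (r * H) ≤ Real.pi * (r * (H : ℝ) ^ 2) := mul_le_mul_of_nonneg_left hrHH hπ.le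
    calc Real.pi * r * H = Real.pi * (r * H) := by ring
      _ ≤ c₆ := h1.trans (hπrH2.trans hπc₆)
  have hTH2 : Real.pi * r * (H : ℝ) ^ 2 ≤ c₇ := by
    calc Real.pi * r * (H : ℝ) ^ 2 = Real.pi * (r * (H : ℝ) ^ 2) := by ring
      _ ≤ c₇ := hπrH2.trans hπc₇
  -- the relative error `ε = C₆⁺ π r H ≤ 1/2`
  set ε : ℝ := C₆p * (Real.pi * r) * H with hεdef
  have hε0 : 0 ≤ ε := by positivity
  have hεle : ε ≤ 1 / 2 := by
    have h1 : ε ≤ C₆p * (Real.pi * c₀) := by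
      calc ε = C₆p * (Real.pi * (r * H)) := by rw [hεdef]; ring
        _ ≤ C₆p * (Real.pi * (r * (H : ℝ) ^ 2)) := mul_le_mul_of_nonneg_left (mul_le_mul_of_nonneg_left hrHH hπ.le) hC₆p0
        _ ≤ C₆p * (Real.pi * c₀) := mul_le_mul_of_nonneg_left hπrH2 hC₆p0
    have h3 : c₀ * (2 * Real.pi * C₆p + 1) ≤ 1 := by
      rw [← le_div_iff₀ (by positivity)]; exact hc₀ε
    have h4 : C₆p * (Real.pi * c₀) = (c₀ * (2 * Real.pi * C₆p + 1) - c₀) / 2 := by ring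
    rw [h4] at h1
    linarith only [h1, h3, hc₀pos]
  have hε1 : ε ≤ 1 := by linarith
  -- the action sandwich at level `T`
  have hsand : ∀ a : LandauFree H → E3, (∀ e, ‖a e‖ ≤ Real.pi * r) →
      |boxWilson H (edgeChart H a) + landauPhi H (edgeChart H a) - boxQuadForm H a| ≤ ε * boxQuadForm H a := by
    intro a ha
    have h := h6a H hH (Real.pi * r) hT0 hTH a ha
    have hQ := BoxQuadForm.boxQuadForm_nonneg hH a
    refine h.trans ?_
    rw [hεdef]
    have : C₆ * (Real.pi * r) * H ≤ C₆p * (Real.pi * r) * H :=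
      mul_le_mul_of_nonneg_right (mul_le_mul_of_nonneg_right (le_max_left _ _) hT0) (Nat.cast_nonneg _)
    exact mul_le_mul_of_nonneg_right this hQ
  -- the determinant comparison at level `T`, against the base point `0`
  set K : ℝ := Real.exp (C₇p * (Real.pi * r) * (H : ℝ) ^ 5) with hKdef
  have hK : 0 < K := Real.exp_pos _
  set D₀ : ℝ := |(fpOperator H (edgeChart H 0)).det| with hD₀def
  have hD₀ : 0 ≤ D₀ := abs_nonneg _
  have h0mem : (0 : LandauFree H → E3) ∈ smallField H (Real.pi * r) := fun e => by simp [hT0]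
  have hKle : Real.exp (C₇ * (Real.pi * r) * (H : ℝ) ^ 5) ≤ K :=
    Real.exp_le_exp.2 (mul_le_mul_of_nonneg_right (mul_le_mul_of_nonneg_right (le_max_left _ _) hT0) (by positivity))
  have hdet : ∀ a : LandauFree H → E3, a ∈ smallField H (Real.pi * r) →
      |(fpOperator H (edgeChart H a)).det| ≤ K * D₀ ∧ D₀ ≤ K * |(fpOperator H (edgeChart H a)).det| := by
    intro a ha
    constructor
    · exact (h6b H hH _ hT0 hTH2 a 0 ha h0mem).trans (mul_le_mul_of_nonneg_right hKle hD₀)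
    · exact (h6b H hH _ hT0 hTH2 0 a h0mem ha).trans (mul_le_mul_of_nonneg_right hKle (abs_nonneg _))
  clear_value D₀
  clear h6a h6b hC₃'
  -- the two integral bounds
  have hU := setIntegral_diff_le (H := H) (s := s) hβpos hr.le hs.le hεle hK.le hD₀ hC₃pos hvar hsand (fun a ha => (hdet a ha).1)
  have ht0 : 0 ≤ s / 2 := by linarith
  have htr : s / 2 ≤ r := by linarith
  have ht1 : s / 2 ≤ 1 := by linarith
  have htT : s / 2 ≤ Real.pi * r := by
    have h3r : 3 * r ≤ Real.pi * r := by nlinarith only [hπ3, hr]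
    linarith only [h3r, hsr, hs]
  have hL := le_setIntegral_smallField hH hβpos hr ht0 htr ht1 htT hε0 hε1 hK hD₀ hC₃pos hvar hsand hdet
  -- abbreviations for the pieces
  set n : ℝ := (Fintype.card (LandauFree H) : ℝ) with hndef
  have hn0 : 0 ≤ n := Nat.cast_nonneg _
  have hn : n ≤ 216 * (H : ℝ) ^ 4 := card_landauFree_le hH
  set P : ℝ := (1 / (2 * Real.pi ^ 2)) ^ Fintype.card (LandauFree H) with hPdef
  have hP : 0 < P := by positivity
  set φ : ℝ := (s / 2) ^ 2 / 3 + (s / 2) ^ 4 with hφdef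
  set G : ℝ := Real.exp (n * φ) with hGdef
  have hG : 0 < G := Real.exp_pos _
  have hGinv : Real.exp (-(n * φ)) = G⁻¹ := by rw [Real.exp_neg]
  set Em : ℝ := Real.exp (-(β * (1 - ε) * s ^ 2 / (3 * C₃))) with hEm
  set Ep : ℝ := Real.exp (-(β * (1 + ε) * (s / 2) ^ 2 / (3 * C₃))) with hEp
  set Zp : ℝ := ∫ a : LandauFree H → E3, Real.exp (-(β * (1 + ε) * boxQuadForm H a)) with hZp
  set Zm : ℝ := ∫ a : LandauFree H → E3, Real.exp (-(β * (1 - ε) * boxQuadForm H a)) with hZm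
  have hZppos : 0 < Zp := ChartGauss.integral_exp_neg_mul_boxQuadForm_pos (mul_pos hβpos (by linarith))
  -- the mass ratio `Zm = ρ^N Zp`
  set ρ : ℝ := Real.sqrt (β * (1 + ε) / (β * (1 - ε))) with hρdef
  have hρ0 : 0 ≤ ρ := Real.sqrt_nonneg _
  have hZratio : Zm = ρ ^ Fintype.card (LandauFree H × Fin 3) * Zp :=
    ChartGauss.integral_exp_neg_mul_boxQuadForm_eq_mul (mul_pos hβpos (by linarith)) (mul_pos hβpos (by linarith))
  have hN : (Fintype.card (LandauFree H × Fin 3) : ℝ) = 3 * n := by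
    rw [Fintype.card_prod, Fintype.card_fin]; push_cast; rw [hndef]; ring
  have hρN : ρ ^ Fintype.card (LandauFree H × Fin 3) ≤ Real.exp (6 * n * ε) := by
    have h1 : ρ ≤ Real.exp (2 * ε) := by
      rw [hρdef, mul_div_mul_left _ _ hβpos.ne']
      exact sqrt_ratio_le_exp hε0 hεle
    calc ρ ^ Fintype.card (LandauFree H × Fin 3) ≤ Real.exp (2 * ε) ^ Fintype.card (LandauFree H × Fin 3) :=
          pow_le_pow_left₀ hρ0 h1 _
      _ = Real.exp (6 * n * ε) := by rw [← Real.exp_nat_mul, hN]; ring_nf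
  -- the denominator keeps half the mass
  have h144 : 144 * C₃ ≤ C := by rw [hCdef]; linarith only [hCexp0]
  have hhalf : 1 / 2 ≤ 1 - 6 * n * Ep := half_le_one_sub hH hβpos hn hε0 hC₃pos h144 hCβ
  -- the lower bound in the convenient form `B' ≤ ∫_I w`
  have hc : 0 ≤ K⁻¹ * D₀ * (P * G⁻¹) := mul_nonneg (mul_nonneg (inv_nonneg.mpr hK.le) hD₀) (mul_nonneg hP.le (inv_nonneg.mpr hG.le))
  have hB : K⁻¹ * D₀ * (P * G⁻¹) * (1 / 2 * Zp) ≤ ∫ a in smallField H (s / 2), fpChartWeight β H r a := by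
    refine le_trans ?_ hL
    rw [hGinv]
    exact mul_le_mul_of_nonneg_left (mul_le_mul_of_nonneg_right hhalf hZppos.le) hc
  -- the upper bound in the convenient form `∫_O w ≤ bracket * B'`
  have hA : ∫ a in chartDomain H \ smallField H s, fpChartWeight β H r a ≤
      (12 * n * Em * ρ ^ Fintype.card (LandauFree H × Fin 3) * K ^ 2 * G) * (K⁻¹ * D₀ * (P * G⁻¹) * (1 / 2 * Zp)) := by
    refine hU.trans (le_of_eq ?_)
    rw [hZratio]
    have hK1 : K * K⁻¹ = 1 := mul_inv_cancel₀ hK.ne'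
    have hG1 : G * G⁻¹ = 1 := mul_inv_cancel₀ hG.ne'
    calc _ = K * D₀ * P * (6 * n * Em * (ρ ^ Fintype.card (LandauFree H × Fin 3) * Zp)) * (K * K⁻¹) * (G * G⁻¹) := by
          rw [hK1, hG1, mul_one, mul_one]
      _ = _ := by ring
  -- the bracket is at most `C H⁴ e^{C r H⁵ − c β s²}`
  have hbracket : 12 * n * Em * ρ ^ Fintype.card (LandauFree H × Fin 3) * K ^ 2 * G ≤
      C * (H : ℝ) ^ 4 * Real.exp (C * r * (H : ℝ) ^ 5 - 1 / (6 * C₃) * β * s ^ 2) :=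
    bracket_le hH hβpos hs hsr hr1 hn hN hε0 hεle rfl hC₆p0 hC₇p0 hC₃pos
  -- conclude
  have hB'0 : 0 ≤ K⁻¹ * D₀ * (P * G⁻¹) * (1 / 2 * Zp) := mul_nonneg hc (mul_nonneg (by norm_num) hZppos.le)
  have hF0 : 0 ≤ C * (H : ℝ) ^ 4 * Real.exp (C * r * (H : ℝ) ^ 5 - 1 / (6 * C₃) * β * s ^ 2) :=
    mul_nonneg (mul_nonneg hC0 (pow_nonneg (Nat.cast_nonneg _) 4)) (Real.exp_pos _).le
  calc ∫ a in chartDomain H \ smallField H s, fpChartWeight β H r a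
      ≤ (12 * n * Em * ρ ^ Fintype.card (LandauFree H × Fin 3) * K ^ 2 * G) * (K⁻¹ * D₀ * (P * G⁻¹) * (1 / 2 * Zp)) := hA
    _ ≤ (C * (H : ℝ) ^ 4 * Real.exp (C * r * (H : ℝ) ^ 5 - 1 / (6 * C₃) * β * s ^ 2)) * (K⁻¹ * D₀ * (P * G⁻¹) * (1 / 2 * Zp)) :=
        mul_le_mul_of_nonneg_right hbracket hB'0
    _ ≤ C * (H : ℝ) ^ 4 * Real.exp (C * r * (H : ℝ) ^ 5 - 1 / (6 * C₃) * β * s ^ 2) *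
          ∫ a in smallField H (s / 2), fpChartWeight β H r a :=
        mul_le_mul_of_nonneg_left hB hF0

end SmallFieldFP

end Summit.QuantumFields.YangMills.Theorems.AllWindowsColdBoxBoxHighLine
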